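import Literature.Probability.RandomPlanarGeometry.ChordalCurveFamilyProofs
import HarnessLib

/-!
# Dyadic outer approximation of compact planar sets, and trace-dependence of stopping:
# partial helper for stub `stub_slitHandOff` (R2″) of line `hitting-tournament` for crux
# `LagHandOff` (stmt-CriticalPhenomena-10268)

Deterministic plane topology used by the reduction `stub_slitHandOff_of_dyadic`
(`…LagHandOffSlitHandOffDyadic.lean`) of the slit hand-off to the countable class `𝒟` of
**dyadic polygons** — finite unions of closed dyadic squares
`[i 2⁻ⁿ, (i+1) 2⁻ⁿ] × [j 2⁻ⁿ, (j+1) 2⁻ⁿ]`, `(i, j) ∈ ℤ²`, of one level `n`.  To keep the file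
definition-free the squares enter through a section variable `sq n (i, j)` constrained by its
defining equation `hsq`; the registered statement instantiates it.

* Level-`n` squares: closed; every point lies in the square of index `(⌊2ⁿ re z⌋, ⌊2ⁿ im z⌋)`;
  two points of one square are within `2 · 2⁻ⁿ`; a level-`n+1` square lies in its level-`n`
  parent (index halved).  Outer approximation `⋃ {sq n p | sq n p ∩ C ≠ ∅}` of a set `C`:
  contains `C`, DECREASES with `n`, lies within `2 · 2⁻ⁿ` of `C` — so the intersection over `n`
  is `C` for closed `C` — and is a finite union (a dyadic polygon, in particular closed) for
  bounded `C`.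
* `stub_slitHandOff_dyadicApprox` — registered form: every compact `C ⊆ ℂ` is the intersection
  of an antitone sequence of dyadic polygons containing it.
* `hitParam_congr_mem`, `stopAt_startFrom_congr_of_range` — the first hitting parameter, hence
  the initial and final pieces `stopAt A`, `startFrom A` of a (class of a) curve, depend on the
  set `A` only through its points on the trace: curves carried by a set `W` do not distinguish
  `A` from `A'` when `A ∩ W = A' ∩ W`.

References: M. Aizenman, A. Burchard, Duke Math. J. 99 (1999) §2.1 (curve space); the dyadic
statements are folklore.
-/

noncomputable section

open Set Filter Topology Metric
open scoped unitInterval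
open Literature.Probability.RandomPlanarGeometry

namespace Summit.CriticalPhenomena.CardyFormulaZ2.Cruxes.LagHandOff.HittingTournament

section Intervals

/-- A real number lies in the level-`n` dyadic interval indexed by `⌊2ⁿ x⌋`. [folklore] -/
theorem mem_Icc_floor_two_pow (n : ℕ) (x : ℝ) :
    x ∈ Set.Icc ((⌊(2 : ℝ) ^ n * x⌋ : ℝ) / 2 ^ n) (((⌊(2 : ℝ) ^ n * x⌋ : ℝ) + 1) / 2 ^ n) := by
  have h2 : (0 : ℝ) < 2 ^ n := pow_pos two_pos n
  constructor
  · rw [div_le_iff₀ h2]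
    have := Int.floor_le ((2 : ℝ) ^ n * x)
    linarith
  · rw [le_div_iff₀ h2]
    have := Int.lt_floor_add_one ((2 : ℝ) ^ n * x)
    linarith

/-- Two reals in one level-`n` dyadic interval are within `2⁻ⁿ`. [folklore] -/
theorem abs_sub_le_of_mem_Icc_two_pow {n : ℕ} {a : ℤ} {x y : ℝ}
    (hx : x ∈ Set.Icc ((a : ℝ) / 2 ^ n) (((a : ℝ) + 1) / 2 ^ n))
    (hy : y ∈ Set.Icc ((a : ℝ) / 2 ^ n) (((a : ℝ) + 1) / 2 ^ n)) : |x - y| ≤ 1 / 2 ^ n := by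
  have h : ((a : ℝ) + 1) / 2 ^ n = (a : ℝ) / 2 ^ n + 1 / 2 ^ n := by rw [add_div]
  rw [h] at hx hy
  rw [abs_sub_le_iff]
  constructor <;> linarith [hx.1, hx.2, hy.1, hy.2]

/-- A level-`n+1` dyadic interval lies in its level-`n` parent (index `a / 2`, floor division).
[folklore] -/
theorem mem_Icc_ediv_of_mem_Icc_two_pow {n : ℕ} {a : ℤ} {x : ℝ}
    (hx : x ∈ Set.Icc ((a : ℝ) / 2 ^ (n + 1)) (((a : ℝ) + 1) / 2 ^ (n + 1))) :
    x ∈ Set.Icc (((a / 2 : ℤ) : ℝ) / 2 ^ n) ((((a / 2 : ℤ) : ℝ) + 1) / 2 ^ n) := by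
  have h2 : (0 : ℝ) < 2 ^ n := pow_pos two_pos n
  have h2' : (0 : ℝ) < 2 ^ (n + 1) := pow_pos two_pos (n + 1)
  have hlo : ((a / 2 : ℤ) : ℝ) * 2 ≤ a := by exact_mod_cast Int.ediv_mul_le a two_ne_zero
  have hhi : (a : ℝ) + 1 ≤ (((a / 2 : ℤ) : ℝ) + 1) * 2 := by
    have h : a + 1 ≤ (a / 2 + 1) * 2 := Int.lt_ediv_add_one_mul_self a two_pos
    exact_mod_cast h
  obtain ⟨hx1, hx2⟩ := hx
  rw [div_le_iff₀ h2', pow_succ] at hx1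
  rw [le_div_iff₀ h2', pow_succ] at hx2
  constructor
  · rw [div_le_iff₀ h2]
    nlinarith
  · rw [le_div_iff₀ h2]
    nlinarith

/-- The integers indexing level-`n` dyadic intervals that contain a real of size `≤ R` form a
bounded set. [folklore] -/
theorem mem_Icc_of_mem_Icc_two_pow {n : ℕ} {R : ℝ} {a : ℤ} {x : ℝ} (hx : |x| ≤ R)
    (hmem : x ∈ Set.Icc ((a : ℝ) / 2 ^ n) (((a : ℝ) + 1) / 2 ^ n)) :
    a ∈ Set.Icc (-(⌈(2 : ℝ) ^ n * R⌉ + 1)) (⌈(2 : ℝ) ^ n * R⌉ + 1) := by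
  have h2 : (0 : ℝ) < 2 ^ n := pow_pos two_pos n
  have hceil : (2 : ℝ) ^ n * R ≤ ⌈(2 : ℝ) ^ n * R⌉ := Int.le_ceil _
  obtain ⟨hx1, hx2⟩ := abs_le.1 hx
  obtain ⟨h1, h3⟩ := hmem
  rw [div_le_iff₀ h2] at h1
  rw [le_div_iff₀ h2] at h3
  have a1 : x * 2 ^ n ≤ R * 2 ^ n := mul_le_mul_of_nonneg_right hx2 h2.le
  have a2 : -R * 2 ^ n ≤ x * 2 ^ n := mul_le_mul_of_nonneg_right hx1 h2.le
  constructor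
  · have h : ((-(⌈(2 : ℝ) ^ n * R⌉ + 1) : ℤ) : ℝ) ≤ a := by
      push_cast
      linarith
    exact_mod_cast h
  · have h : (a : ℝ) ≤ ((⌈(2 : ℝ) ^ n * R⌉ + 1 : ℤ) : ℝ) := by
      push_cast
      linarith
    exact_mod_cast h

end Intervals

section Dyadic

variable (sq : ℕ → ℤ × ℤ → Set ℂ)
  (hsq : ∀ (n : ℕ) (p : ℤ × ℤ), sq n p = {z : ℂ | z.re ∈ Set.Icc ((p.1 : ℝ) / 2 ^ n)
    (((p.1 : ℝ) + 1) / 2 ^ n) ∧ z.im ∈ Set.Icc ((p.2 : ℝ) / 2 ^ n) (((p.2 : ℝ) + 1) / 2 ^ n)})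

include hsq

/-- Dyadic squares are closed. [folklore] -/
theorem isClosed_sq (n : ℕ) (p : ℤ × ℤ) : IsClosed (sq n p) := by
  rw [hsq]
  exact (isClosed_Icc.preimage Complex.continuous_re).inter
    (isClosed_Icc.preimage Complex.continuous_im)

/-- Every point lies in the level-`n` dyadic square of index `(⌊2ⁿ re z⌋, ⌊2ⁿ im z⌋)`. [folklore] -/
theorem mem_sq_floor (n : ℕ) (z : ℂ) : z ∈ sq n (⌊(2 : ℝ) ^ n * z.re⌋, ⌊(2 : ℝ) ^ n * z.im⌋) := by
  rw [hsq]
  exact ⟨mem_Icc_floor_two_pow n z.re, mem_Icc_floor_two_pow n z.im⟩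

/-- Two points of one level-`n` dyadic square are within `2 · 2⁻ⁿ`. [folklore] -/
theorem dist_le_of_mem_sq {n : ℕ} {p : ℤ × ℤ} {z w : ℂ} (hz : z ∈ sq n p) (hw : w ∈ sq n p) :
    dist z w ≤ 2 / 2 ^ n := by
  rw [hsq] at hz hw
  rw [Complex.dist_eq]
  refine (Complex.norm_le_abs_re_add_abs_im _).trans ?_
  rw [Complex.sub_re, Complex.sub_im]
  have h1 := abs_sub_le_of_mem_Icc_two_pow hz.1 hw.1
  have h2 := abs_sub_le_of_mem_Icc_two_pow hz.2 hw.2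
  have h3 : (1 : ℝ) / 2 ^ n + 1 / 2 ^ n = 2 / 2 ^ n := by ring
  linarith

/-- A level-`n+1` dyadic square lies in its level-`n` parent. [folklore] -/
theorem sq_succ_subset (n : ℕ) (p : ℤ × ℤ) : sq (n + 1) p ⊆ sq n (p.1 / 2, p.2 / 2) := by
  intro z hz
  rw [hsq] at hz ⊢
  exact ⟨mem_Icc_ediv_of_mem_Icc_two_pow hz.1, mem_Icc_ediv_of_mem_Icc_two_pow hz.2⟩

omit hsq in
/-- Membership in the level-`n` **dyadic outer approximation** `⋃ {sq n p | sq n p ∩ C ≠ ∅}` of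
a set `C`. [folklore] -/
theorem mem_outer_iff {n : ℕ} {C : Set ℂ} {z : ℂ} :
    z ∈ (⋃ p ∈ {p : ℤ × ℤ | (sq n p ∩ C).Nonempty}, sq n p) ↔
      ∃ p : ℤ × ℤ, (sq n p ∩ C).Nonempty ∧ z ∈ sq n p := by
  simp only [mem_iUnion, mem_setOf_eq, exists_prop]

/-- The outer approximation contains the set. [folklore] -/
theorem subset_outer (n : ℕ) (C : Set ℂ) : C ⊆ ⋃ p ∈ {p : ℤ × ℤ | (sq n p ∩ C).Nonempty}, sq n p :=
  fun z hz => (mem_outer_iff sq).2 ⟨_, ⟨z, mem_sq_floor sq hsq n z, hz⟩, mem_sq_floor sq hsq n z⟩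

/-- The outer approximations decrease with the level. [folklore] -/
theorem antitone_outer (C : Set ℂ) :
    Antitone fun n => ⋃ p ∈ {p : ℤ × ℤ | (sq n p ∩ C).Nonempty}, sq n p := by
  refine antitone_nat_of_succ_le fun n z hz => ?_
  obtain ⟨p, ⟨w, hwQ, hwC⟩, hzQ⟩ := (mem_outer_iff sq).1 hz
  exact (mem_outer_iff sq).2 ⟨(p.1 / 2, p.2 / 2), ⟨w, sq_succ_subset sq hsq n p hwQ, hwC⟩,
    sq_succ_subset sq hsq n p hzQ⟩

/-- **The outer approximations of a closed set decrease to it** (every point of the level-`n`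
approximation is within `2 · 2⁻ⁿ` of the set). [folklore] -/
theorem iInter_outer {C : Set ℂ} (hC : IsClosed C) :
    (⋂ n, ⋃ p ∈ {p : ℤ × ℤ | (sq n p ∩ C).Nonempty}, sq n p) = C := by
  refine Subset.antisymm (fun z hz => ?_) (subset_iInter fun n => subset_outer sq hsq n C)
  rw [mem_iInter] at hz
  rw [← hC.closure_eq, Metric.mem_closure_iff]
  intro ε hε
  obtain ⟨n, hn⟩ := exists_pow_lt_of_lt_one (half_pos hε) (by norm_num : (1 / 2 : ℝ) < 1)
  obtain ⟨p, ⟨w, hwQ, hwC⟩, hzQ⟩ := (mem_outer_iff sq).1 (hz n)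
  refine ⟨w, hwC, (dist_le_of_mem_sq sq hsq hzQ hwQ).trans_lt ?_⟩
  have h : (2 : ℝ) / 2 ^ n = 2 * (1 / 2) ^ n := by
    rw [one_div, inv_pow]
    ring
  rw [h]
  linarith

/-- Only finitely many level-`n` dyadic squares meet a bounded set. [folklore] -/
theorem finite_setOf_sq_inter_nonempty {C : Set ℂ} (hC : Bornology.IsBounded C) (n : ℕ) :
    {p : ℤ × ℤ | (sq n p ∩ C).Nonempty}.Finite := by
  obtain ⟨R, hR⟩ := hC.subset_closedBall 0
  refine ((Set.finite_Icc (-(⌈(2 : ℝ) ^ n * R⌉ + 1)) (⌈(2 : ℝ) ^ n * R⌉ + 1)).prod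
    (Set.finite_Icc (-(⌈(2 : ℝ) ^ n * R⌉ + 1)) (⌈(2 : ℝ) ^ n * R⌉ + 1))).subset ?_
  rintro p ⟨z, hzQ, hzC⟩
  rw [hsq] at hzQ
  have hz : ‖z‖ ≤ R := by
    have h := hR hzC
    rwa [Metric.mem_closedBall, dist_zero_right] at h
  exact ⟨mem_Icc_of_mem_Icc_two_pow ((Complex.abs_re_le_norm z).trans hz) hzQ.1,
    mem_Icc_of_mem_Icc_two_pow ((Complex.abs_im_le_norm z).trans hz) hzQ.2⟩

/-- **The outer approximation of a bounded set is a dyadic polygon** (a finite union of closed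
level-`n` dyadic squares). [folklore] -/
theorem exists_finset_outer_eq {C : Set ℂ} (hC : Bornology.IsBounded C) (n : ℕ) :
    ∃ s : Finset (ℤ × ℤ), (⋃ p ∈ {p : ℤ × ℤ | (sq n p ∩ C).Nonempty}, sq n p) = ⋃ p ∈ s, sq n p := by
  refine ⟨(finite_setOf_sq_inter_nonempty sq hsq hC n).toFinset, ?_⟩
  ext z
  simp only [mem_iUnion, Finite.mem_toFinset, mem_setOf_eq, exists_prop]

/-- The outer approximation of a bounded set is closed. [folklore] -/
theorem isClosed_outer {C : Set ℂ} (hC : Bornology.IsBounded C) (n : ℕ) :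
    IsClosed (⋃ p ∈ {p : ℤ × ℤ | (sq n p ∩ C).Nonempty}, sq n p) := by
  obtain ⟨s, hs⟩ := exists_finset_outer_eq sq hsq hC n
  rw [hs]
  exact isClosed_biUnion_finset fun p _ => isClosed_sq sq hsq n p

/-- **Dyadic outer approximation of compact sets**: every compact `C ⊆ ℂ` is the intersection of
an antitone sequence of dyadic polygons containing it. [folklore] -/
theorem exists_dyadic_antitone_iInter_eq {C : Set ℂ} (hC : IsCompact C) :
    ∃ G : ℕ → Set ℂ, (∀ k, ∃ (n : ℕ) (s : Finset (ℤ × ℤ)), G k = ⋃ p ∈ s, sq n p) ∧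
      (∀ k, IsClosed (G k)) ∧ Antitone G ∧ (⋂ k, G k) = C ∧ ∀ k, C ⊆ G k :=
  ⟨fun k => ⋃ p ∈ {p : ℤ × ℤ | (sq k p ∩ C).Nonempty}, sq k p,
    fun k => ⟨k, exists_finset_outer_eq sq hsq hC.isBounded k⟩,
    fun k => isClosed_outer sq hsq hC.isBounded k, antitone_outer sq hsq C,
    iInter_outer sq hsq hC.isClosed, fun k => subset_outer sq hsq k C⟩

end Dyadic

/-- **Registered sub-goal `stub_slitHandOff_dyadicApprox` of `stub_slitHandOff` (R2″)**: every
compact planar set is the intersection of an antitone sequence of DYADIC POLYGONS (finite unions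
of closed dyadic squares `[i 2⁻ⁿ, (i+1) 2⁻ⁿ] × [j 2⁻ⁿ, (j+1) 2⁻ⁿ]` of one level) containing it —
the outer approximations used to reduce the slit hand-off to the countable dyadic class. [folklore] -/
theorem stub_slitHandOff_dyadicApprox : ∀ C : Set ℂ, IsCompact C → ∃ G : ℕ → Set ℂ, (∀ k, ∃ (n : ℕ) (s : Finset (ℤ × ℤ)), G k = ⋃ p ∈ s, {z : ℂ | z.re ∈ Set.Icc ((p.1 : ℝ) / 2 ^ n) (((p.1 : ℝ) + 1) / 2 ^ n) ∧ z.im ∈ Set.Icc ((p.2 : ℝ) / 2 ^ n) (((p.2 : ℝ) + 1) / 2 ^ n)}) ∧ (∀ k, IsClosed (G k)) ∧ Antitone G ∧ (⋂ k, G k) = C ∧ ∀ k, C ⊆ G k :=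
  fun _ hC => exists_dyadic_antitone_iInter_eq (fun n p => {z : ℂ | z.re ∈ Set.Icc ((p.1 : ℝ) / 2 ^ n)
    (((p.1 : ℝ) + 1) / 2 ^ n) ∧ z.im ∈ Set.Icc ((p.2 : ℝ) / 2 ^ n) (((p.2 : ℝ) + 1) / 2 ^ n)})
    (fun _ _ => rfl) hC

section Trace

variable {E : Type*} [TopologicalSpace E]

/-- The first hitting parameter of `A` by a parametrised curve depends on `A` only through the
points of the curve: if `γ t ∈ A ↔ γ t ∈ B` for all `t` then the hitting parameters agree. [folklore] -/
theorem hitParam_congr_mem {A B : Set E} {γ : Curve E} (h : ∀ t, γ t ∈ A ↔ γ t ∈ B) :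
    γ.hitParam A = γ.hitParam B := by
  simp only [Curve.hitParam, Curve.hitSet, h]

/-- Under the same hypothesis the initial pieces `stopAt A`, `stopAt B` agree as parametrised
curves. [folklore] -/
theorem curve_stopAt_congr_mem {A B : Set E} {γ : Curve E} (h : ∀ t, γ t ∈ A ↔ γ t ∈ B) :
    γ.stopAt A = γ.stopAt B := by
  rw [Curve.stopAt, Curve.stopAt, hitParam_congr_mem h]

/-- Under the same hypothesis the final pieces `startFrom A`, `startFrom B` agree. [folklore] -/
theorem curve_startFrom_congr_mem {A B : Set E} {γ : Curve E} (h : ∀ t, γ t ∈ A ↔ γ t ∈ B) :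
    γ.startFrom A = γ.startFrom B := by
  rw [Curve.startFrom, Curve.startFrom, hitParam_congr_mem h]

/-- The trace of a curve class contains the range of its chosen representative. [folklore] -/
theorem range_out_subset_range {E : Type*} [MetricSpace E] (c : CurveClass E) :
    Set.range c.out ⊆ c.range := by
  conv_rhs => rw [← CurveClass.mk_out c]
  rw [CurveClass.range_mk]
  rfl

/-- **Stopping depends on the stopping set only through the trace.** If two sets `A`, `B` have
the same points on the trace of the curve class `c`, then `c.stopAt A = c.stopAt B` and
`c.startFrom A = c.startFrom B`.  (Used with `B = A ∩ W` and `B = A ∪ F` for classes carried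
by `W`.) [folklore] -/
theorem stopAt_startFrom_congr_of_range {E : Type*} [MetricSpace E] {A B : Set E}
    {c : CurveClass E} (h : ∀ z ∈ c.range, z ∈ A ↔ z ∈ B) :
    c.stopAt A = c.stopAt B ∧ c.startFrom A = c.startFrom B := by
  have h' : ∀ t, c.out t ∈ A ↔ c.out t ∈ B := fun t => h _ (range_out_subset_range c ⟨t, rfl⟩)
  exact ⟨congrArg CurveClass.mk (curve_stopAt_congr_mem h'),
    congrArg CurveClass.mk (curve_startFrom_congr_mem h')⟩

end Trace

end Summit.CriticalPhenomena.CardyFormulaZ2.Cruxes.LagHandOff.HittingTournament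

end
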